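import Summits.NavierStokesRegularity.NavierStokesRegularity.Theorems.ExtremiserTransienceNearExtremalTransienceExtremiserLiouvilleConstantSpeedBlowDownStokeslet
import Summits.NavierStokesRegularity.NavierStokesRegularity.Theorems.ExtremiserTransienceNearExtremalTransienceExtremiserLiouvilleConstantSpeedJetAxialPairing
import Summits.NavierStokesRegularity.NavierStokesRegularity.Theorems.ExtremiserTransienceNearExtremalTransienceExtremiserLiouvilleConstantSpeedTools
import HarnessLib

/-!
# Crux `ExtremiserTransience.NearExtremalTransience` (stmt-NavierStokesRegularity-21883), line `extremiser_liouville`,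
# stub K1b — THE JET'S MULTIPLIER HAS NO BARYCENTRE ALONG «HORIZONTAL-GRADIENT» TEST FIELDS: `⟪Ψ(0), ∫v dμ⟫ = 0`

`--supports stmt-NavierStokesRegularity-21883` (helper).  Author: prover seat `ns-el-k1b` (g5).  Combines the Stokeslet law
(`…ConstantSpeedBlowDownStokeslet`: `κ⋆²M²W·R⁻²∫⟪v − c, (ΔΨ)(x/R)⟫dx → ⟪Ψ(0), b⟫`, `b = ∫v dμ`) with the horizontality of the
jet (`…ConstantSpeedJetAxialPairing`: `R⁻²∫ V₂(x)G₂(x/R)dx → 0`, `V = v − c`, axial frame `c = (0,0,c₂)`).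

* `integral_inner_gradient_rescale_eq_zero` : `∫⟪V(x), (∇g)(R⁻¹x)⟫dx = 0` for `V ∈ C¹` divergence free and `g ∈ C¹_c` (`R > 0`).
* `inner_barycentre_eq_zero_of_horizontalGradient` : for the residue JET (axial frame) with multiplier `μ`, and every solenoidal
  test field `Ψ ∈ C_c^∞` whose Laplacian is HORIZONTALLY A GRADIENT — `(ΔΨ)ᵢ = ∂ᵢg` for `i = 0, 1` and some `g ∈ C¹_c` —
  **`⟪Ψ(0), ∫ v dμ⟫ = 0`**.  Proof: `∫⟪V, (ΔΨ)(x/R)⟫ = ∫⟪V, (∇g)(x/R)⟫ + ∫V₂·((ΔΨ)₂ − ∂₂g)(x/R) = 0 + (axial pairing)`,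
  and `R⁻²·(axial pairing) → 0`, while the Stokeslet law gives the limit `⟪Ψ(0), b⟫/(κ⋆²M²W)`.

READING (record §6).  The fields `Ψ_φ = ∇(∂₂φ) − (Δφ)e₂ = curl curl(φ e₂)` (`φ ∈ C_c^∞`) are solenoidal with
`ΔΨ_φ = ∇(∂₂Δφ) − (Δ²φ)e₂`, i.e. horizontally the gradient of `g = ∂₂Δφ`, and `Ψ_φ(0) = (∂₀∂₂φ, ∂₁∂₂φ, −Δ_hφ)(0)` is arbitrary:
so this theorem yields **`b = ∫ v dμ = 0` for every residue JET**, hence (g3's `…MultiplierIdentities`) `μ(ℝ³) = κ⋆²ZW` exactly and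
`∫⟪v, c⟫dμ = 0`; and the Stokeslet law degenerates to `κ⋆²M²W·ΔV_R → 0`: the jet's blow-downs are Stokes-harmonic across the
origin.  (The three-line verification of the test family `Ψ_φ` is left to the next seat; everything else is here.)

WHAT THIS IS NOT: K1b is NOT proved; nothing here proves NS regularity. [folklore]
-/

noncomputable section

open Set Filter Topology MeasureTheory Metric Function
open scoped ENNReal NNReal Topology InnerProductSpace RealInnerProductSpace ContDiff Laplacian
open Literature.Analysis.FluidPDE Literature.Analysis

namespace Summit.NavierStokesRegularity.NavierStokesRegularity.Theorems

-- the problem directory repeats the summit name (`NavierStokesRegularity/NavierStokesRegularity`)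
set_option linter.dupNamespace false

namespace ExtremiserLiouville

open DepletionLadder.KStar DepletionLadder.KStar.HalfSpace

variable {v V Ψ : E3 → E3} {c : E3}

/-! ## Gradients pair to zero with divergence-free fields, at every scale -/

/-- Components of the gradient: `(∇g)(y)ᵢ = ∂ᵢg(y)`. [folklore] -/
theorem gradient_apply_eq_fderiv (g : E3 → ℝ) (y : E3) (i : Fin 3) :
    gradient g y i = fderiv ℝ g y (EuclideanSpace.single i (1 : ℝ)) := by
  have h : ⟪gradient g y, EuclideanSpace.single i (1 : ℝ)⟫_ℝ = fderiv ℝ g y (EuclideanSpace.single i (1 : ℝ)) := by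
    rw [gradient, InnerProductSpace.toDual_symm_apply]
  rw [EuclideanSpace.inner_single_right] at h
  simpa using h

/-- `⟪u, ∇g(y)⟫ = Dg(y)·u`. [folklore] -/
theorem inner_gradient_right_eq_fderiv (g : E3 → ℝ) (y u : E3) : ⟪u, gradient g y⟫_ℝ = fderiv ℝ g y u := by
  rw [real_inner_comm, gradient, InnerProductSpace.toDual_symm_apply]

/-- **`∫⟪V(x), (∇g)(R⁻¹x)⟫dx = 0`** for `V ∈ C¹` divergence free, `g ∈ C¹_c`, `R > 0` (the rescaled `g(R⁻¹·)` is again a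
compactly supported `C¹` scalar, and `∫ D(g(R⁻¹·))·V = 0`). [folklore] -/
theorem integral_inner_gradient_rescale_eq_zero (hV : ContDiff ℝ 1 V) (hVdiv : VectorCalculus.IsDivFree V)
    {g : E3 → ℝ} (hg : ContDiff ℝ 1 g) (hgc : HasCompactSupport g) {R : ℝ} (hR : 0 < R) :
    ∫ x, ⟪V x, gradient g (R⁻¹ • x)⟫_ℝ = 0 := by
  set gR : E3 → ℝ := fun x => g (R⁻¹ • x) with hgR
  have hgR1 : ContDiff ℝ 1 gR := hg.comp (contDiff_id.const_smul R⁻¹)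
  have hgRc : HasCompactSupport gR := hgc.comp_smul (inv_ne_zero hR.ne')
  have hD : ∀ x, fderiv ℝ gR x = R⁻¹ • fderiv ℝ g (R⁻¹ • x) := by
    intro x
    have h1 : HasFDerivAt (fun x : E3 => R⁻¹ • x) (R⁻¹ • ContinuousLinearMap.id ℝ E3) x :=
      (hasFDerivAt_id x).const_smul R⁻¹
    have h2 : HasFDerivAt g (fderiv ℝ g (R⁻¹ • x)) (R⁻¹ • x) :=
      (hg.differentiable one_ne_zero _).hasFDerivAt
    have h : HasFDerivAt gR ((fderiv ℝ g (R⁻¹ • x)).comp (R⁻¹ • ContinuousLinearMap.id ℝ E3)) x := h2.comp x h1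
    rw [h.fderiv]
    ext w
    simp
  have h0 := integral_fderiv_apply_eq_zero_of_isDivFree hgR1 hV hVdiv (hgRc.smul_right (f' := V))
  have e : ∀ x, ⟪V x, gradient g (R⁻¹ • x)⟫_ℝ = R * fderiv ℝ gR x (V x) := by
    intro x
    rw [inner_gradient_right_eq_fderiv, hD]
    show fderiv ℝ g (R⁻¹ • x) (V x) = R * (R⁻¹ • fderiv ℝ g (R⁻¹ • x) (V x))
    rw [smul_eq_mul, ← mul_assoc, mul_inv_cancel₀ hR.ne', one_mul]
  simp_rw [e]
  rw [integral_const_mul, h0, mul_zero]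

/-! ## `⟪Ψ(0), b⟫ = 0` along horizontal-gradient test fields -/

/-- **The jet's multiplier barycentre is orthogonal to `Ψ(0)` for every solenoidal `Ψ` whose Laplacian is horizontally a
gradient.**  Setting: `v` smooth, divergence free, `‖v‖ ≡ M`, `D¹v, D²v ∈ L²`; `μ` a finite measure with the multiplier equation;
axial far field `c = (0,0,c₂)`, `‖c‖ = M`; JET data for `V = v − c` (all slabs square integrable, window energies `≡ E₀` on
`[0,1]`); `Ψ ∈ C_c^∞` solenoidal and `g ∈ C¹_c` with `(ΔΨ)(y)ᵢ = ∂ᵢ g(y)` for `i ≠ 2`.  Then **`⟪Ψ 0, ∫ v dμ⟫ = 0`**. [folklore] -/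
theorem inner_barycentre_eq_zero_of_horizontalGradient (hv : ContDiff ℝ ∞ v) (hdiv : VectorCalculus.IsDivFree v) {M : ℝ}
    (hM : ∀ x, ‖v x‖ = M) (h1 : ∫⁻ x, ‖iteratedFDeriv ℝ 1 v x‖ₑ ^ 2 < ⊤) (h2 : ∫⁻ x, ‖iteratedFDeriv ℝ 2 v x‖ₑ ^ 2 < ⊤)
    (μ : Measure E3) [IsFiniteMeasure μ]
    (hμ : ∀ φ : E3 → E3, ContDiff ℝ ∞ φ → HasCompactSupport φ → VectorCalculus.IsDivFree φ →
      Jst v * J1 v φ - kStar ^ 2 * M ^ 2 * (Wpa v * A1 v φ + Zen v * C1 v φ) = ∫ x, ⟪v x, φ x⟫_ℝ ∂μ)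
    (hc0 : c 0 = 0) (hc1 : c 1 = 0) (hc2 : c 2 ≠ 0) (hcM : ‖c‖ = M)
    (hL2 : ∀ T : ℝ, Integrable (fun x => {x : E3 | |x 2| ≤ T}.indicator (fun x => ‖v x - c‖ ^ 2) x) volume)
    {E₀ : ℝ} (hE : ∀ u ∈ Icc (0 : ℝ) 1, (∫ x : E3, deriv Real.smoothTransition (x 2 - u) * ‖v x - c‖ ^ 2) = E₀)
    (hΨ : ContDiff ℝ ∞ Ψ) (hΨc : HasCompactSupport Ψ) (hΨdiv : VectorCalculus.IsDivFree Ψ)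
    {g : E3 → ℝ} (hg : ContDiff ℝ 1 g) (hgc : HasCompactSupport g)
    (hhor : ∀ (y : E3) (i : Fin 3), i ≠ 2 → (Δ Ψ) y i = fderiv ℝ g y (EuclideanSpace.single i (1 : ℝ))) :
    ⟪Ψ 0, ∫ x, v x ∂μ⟫_ℝ = 0 := by
  -- the deviation `V = v − c` and its constant-speed structure
  set V : E3 → E3 := fun x => v x - c with hVdef
  have hV1 : ContDiff ℝ 1 V := (hv.of_le (by norm_cast)).sub contDiff_const
  have hVdiv : VectorCalculus.IsDivFree V := isDivFree_sub_const hdiv c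
  have hVc : ∀ x, ⟪V x, c⟫_ℝ = -(‖V x‖ ^ 2 / 2) := fun x => by
    have h : ‖c + V x‖ = ‖c‖ := by rw [hVdef]; simp only [add_sub_cancel]; rw [hM, hcM]
    exact (inner_eq_of_norm_add_eq h).1
  -- the Laplacian of the test field: continuous with compact support (`ΔΨ = −curl curl Ψ`)
  have hΨ2 : ContDiff ℝ 2 Ψ := hΨ.of_le (by norm_cast)
  have hΔeq : (Δ Ψ) = fun y => -curl (curl Ψ) y := by
    funext y; rw [curl_curl_eq_neg_laplacian hΨ2 hΨdiv y, neg_neg]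
  have hcΨ : ContDiff ℝ ∞ (curl Ψ) := contDiff_curl hΨ
  have hccc : Continuous (curl (curl Ψ)) := continuous_curl (hcΨ.of_le (by norm_cast))
  have hΔc : Continuous (Δ Ψ) := by rw [hΔeq]; exact hccc.neg
  have hΔsupp : HasCompactSupport (Δ Ψ) := by
    rw [hΔeq]
    exact (hasCompactSupport_curl_of (hasCompactSupport_curl_of hΨc)).comp_left (g := fun y : E3 => -y) neg_zero
  -- the gradient of `g`: continuous with compact support
  have hgradc : Continuous (gradient g) := by
    have e : gradient g = fun y => (InnerProductSpace.toDual ℝ E3).symm (fderiv ℝ g y) := rfl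
    rw [e]; exact (InnerProductSpace.toDual ℝ E3).symm.continuous.comp (hg.continuous_fderiv one_ne_zero)
  have hgrads : HasCompactSupport (gradient g) := by
    have e : gradient g = fun y => (InnerProductSpace.toDual ℝ E3).symm (fderiv ℝ g y) := rfl
    rw [e]; exact (hgc.fderiv (𝕜 := ℝ)).comp_left (map_zero _)
  -- the axial remainder `G = ΔΨ − ∇g` (horizontal components zero)
  set G : E3 → E3 := fun y => (Δ Ψ) y + -gradient g y with hGdef
  have hGc : Continuous G := hΔc.add hgradc.neg
  have hGs : HasCompactSupport G := hΔsupp.add (hgrads.comp_left (g := fun y : E3 => -y) neg_zero)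
  have hGh : ∀ (y : E3) (i : Fin 3), i ≠ 2 → G y i = 0 := by
    intro y i hi
    show ((Δ Ψ) y + -gradient g y) i = 0
    rw [PiLp.add_apply, PiLp.neg_apply, gradient_apply_eq_fderiv, hhor y i hi, add_neg_cancel]
  -- the key identity: the Laplacian pairing is an axial pairing (for `R > 0`)
  have hkey : ∀ R : ℝ, 0 < R →
      (∫ x, ⟪v x - c, (Δ Ψ) (R⁻¹ • x)⟫_ℝ) = ∫ x, V x 2 * G (R⁻¹ • x) 2 := by
    intro R hR
    have hsplit : ∀ x, ⟪v x - c, (Δ Ψ) (R⁻¹ • x)⟫_ℝ = V x 2 * G (R⁻¹ • x) 2 + ⟪V x, gradient g (R⁻¹ • x)⟫_ℝ := by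
      intro x
      have eΔ : (Δ Ψ) (R⁻¹ • x) = G (R⁻¹ • x) + gradient g (R⁻¹ • x) := by
        show (Δ Ψ) (R⁻¹ • x) = ((Δ Ψ) (R⁻¹ • x) + -gradient g (R⁻¹ • x)) + gradient g (R⁻¹ • x)
        rw [neg_add_cancel_right]
      rw [show v x - c = V x from rfl, eΔ, inner_add_right]
      congr 1
      -- `⟪V x, G y⟫ = V₂ G₂` since `G₀ = G₁ = 0`
      simp only [PiLp.inner_apply, RCLike.inner_apply, conj_trivial, Fin.sum_univ_three,
        hGh _ 0 (by decide), hGh _ 1 (by decide)]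
      ring
    have iG : Integrable (fun x => V x 2 * G (R⁻¹ • x) 2) volume := by
      have hGR : Continuous fun x : E3 => G (R⁻¹ • x) := hGc.comp (continuous_id.const_smul R⁻¹)
      have hGRc : HasCompactSupport fun x : E3 => G (R⁻¹ • x) := hGs.comp_smul (inv_ne_zero hR.ne')
      refine (((PiLp.continuous_apply 2 _ (2 : Fin 3)).comp hV1.continuous).mul
        ((PiLp.continuous_apply 2 _ (2 : Fin 3)).comp hGR)).integrable_of_hasCompactSupport (hGRc.mono fun x hx => ?_)
      rw [mem_support] at hx ⊢
      contrapose! hx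
      show V x 2 * G (R⁻¹ • x) 2 = 0
      rw [hx, PiLp.zero_apply, mul_zero]
    have igrad : Integrable (fun x => ⟪V x, gradient g (R⁻¹ • x)⟫_ℝ) volume := by
      have hgR : Continuous fun x : E3 => gradient g (R⁻¹ • x) := hgradc.comp (continuous_id.const_smul R⁻¹)
      have hgRc : HasCompactSupport fun x : E3 => gradient g (R⁻¹ • x) := hgrads.comp_smul (inv_ne_zero hR.ne')
      refine (hV1.continuous.inner hgR).integrable_of_hasCompactSupport (hgRc.mono fun x hx => ?_)
      rw [mem_support] at hx ⊢
      contrapose! hx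
      rw [hx, inner_zero_right]
    simp_rw [hsplit]
    rw [integral_add iG igrad, integral_inner_gradient_rescale_eq_zero hV1 hVdiv hg hgc hR, add_zero]
  -- the two limits
  have hA := tendsto_blowDown_laplacian_pairing hv hM h1 h2 μ hμ hΨ hΨc hΨdiv c
  have hB := (tendsto_axial_pairing_rescale hV1 hVdiv hVc hc0 hc1 hc2 hL2 hE hGc hGs).const_mul
    (kStar ^ 2 * M ^ 2 * Wpa v)
  rw [mul_zero] at hB
  have hAB : Tendsto (fun R : ℝ => kStar ^ 2 * M ^ 2 * Wpa v * (R⁻¹ * R⁻¹ * ∫ x, ⟪v x - c, (Δ Ψ) (R⁻¹ • x)⟫_ℝ)) atTop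
      (𝓝 0) := by
    refine hB.congr' ((eventually_gt_atTop 0).mono fun R hR => ?_)
    show kStar ^ 2 * M ^ 2 * Wpa v * (R⁻¹ * R⁻¹ * ∫ x, V x 2 * G (R⁻¹ • x) 2) =
      kStar ^ 2 * M ^ 2 * Wpa v * (R⁻¹ * R⁻¹ * ∫ x, ⟪v x - c, (Δ Ψ) (R⁻¹ • x)⟫_ℝ)
    rw [hkey R hR]
  have hlim : (∫ x, ⟪v x, Ψ 0⟫_ℝ ∂μ) = 0 := tendsto_nhds_unique hA hAB
  -- `∫⟪v, Ψ 0⟫dμ = ⟪Ψ 0, ∫ v dμ⟫`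
  have hvi : Integrable v μ :=
    (integrable_const M).mono' hv.continuous.aestronglyMeasurable (Eventually.of_forall fun x => (hM x).le)
  rw [← integral_inner hvi]
  rw [← hlim]
  exact integral_congr_ae (Eventually.of_forall fun x => real_inner_comm _ _)

end ExtremiserLiouville

end Summit.NavierStokesRegularity.NavierStokesRegularity.Theorems

end
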